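/-
Copyright (c) 2026 the pub-hodgecm-mathlib formalisation cell (harness21).  Prover seat hodgecm-mathlib-R90-C10-p05 (g2), R90-TF SLAB section S1 «Ch10-local» (base
R90-C10), h413 = `stmt-HodgeConjecture-24833`; line «B_pos» = U4Keys :182 `sig_K2E3KeysThmTwoContractingRamifiedCharOnePosDepth` (Keys §7 Thm (2) for `χ₁` of POSITIVE
depth) in BRANCH B («`χ₁(u·σu) = 1` on units») — the d0B programme (K2E3-p06 (g4) DESIGN-M2-v2 (O2), ★ Z2-B `K2E3BranchBDeterminantVanishing` of K2E3-p32 (g0)) run at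
Roche's two-depth level group `J_e` (★ D174): GENERIC brick (B-0) «REDUCIBLE ⟹ det M = 0, CELL-FAMILY FORM».  2026-09-04.
-/
import Summits.HodgeConjecture.HodgeConjecture.Theorems.K2E3BranchBDeterminantVanishing    -- ★ Z2-B (K2E3-p32 (g0)): `eigen_smul_add_smul`, `integral_conj_mul_eq_of_eq_smul_add_smul`, `det_eq_zero_of_kernel_vector_fst_ne_zero`; brings ★ Z2 `K2E3IwahoriPlaneTwoCells`, ★ Z2-gen `K2E3TypeVectorSupport`
import Summits.HodgeConjecture.HodgeConjecture.Theorems.K2E3BranchAContradictionCells     -- ★ A_pos (iv) (K2E3-p37 (g0)) p861573: `toFun_eq_zero_of_mem_cells` (a type vector vanishes on every witnessed cell `H·r·B`)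
import HarnessLib

/-!
# R90-TF S1 «Ch10-local» ∕ K2 E3 «U4Keys» :182, BRANCH B AT POSITIVE DEPTH — brick (B-0), generic: A TYPE VECTOR KILLED BY THE TWO INTERTWINING FUNCTIONALS FORCES
# `det M = 0` WHEN THE TWO RELEVANT CELLS `H·B`, `H·g₀·B` ARE COMPLEMENTED BY A FAMILY OF IRRELEVANT CELLS `H·r·B`, `r ∈ R`
# [Casselman1980 §3; Casselman1995 §6.3–§6.4; Roche1998 §3–§4; Keys1984 §3, §7 Thm (2)]

Cell `pub/hodgecm-mathlib`, crux H413 = `stmt-HodgeConjecture-24833`, route of record `HCCMUnconditional` (no route verbs); R90-TF section S1 (junction socket A2′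
`stub_R90_122_keysThmTwo_ramifiedCharOne` of `Cruxes/H413/Lines/R90_S1_NonsplitLocalPacketsA.lean` = U4Keys :217, REL over :155 and :182).  THEOREMS ONLY (no `def`, no
`instance`, no `notation`, no named-fact hypothesis, no `sorry`); lane `--supports stmt-HodgeConjecture-24833 --as helper`, count-neutral.  NOT THE PAYER of :182.

THE POINT.  ★ Z2-B `K2E3BranchBDeterminantVanishing.det_intertwiningIntegral_eq_zero_of_typeVector` needs the TWO-CELL COVER `G = H·B ∪ H·g₀·B` — true for the Iwahori
`B = I` (depth zero), FALSE for a positive-depth level group `B = J_e` (★ D174 `K2E3IwahoriTwoDepthFactorisation`): besides the closed cell `P·J_e` and the sharp big cell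
`P·w·J_e` there are INTERMEDIATE cells `P·ū(x,z)·J_e`.  In Branch B at positive depth those cells are `θ`-IRRELEVANT — each representative `r` carries a DEPTH WITNESS
`b_r ∈ J_e`, `r b_r r⁻¹ ∈ P`, `θ(b_r) ≠ (χδ^{1∕2})(r b_r r⁻¹)` (★ p862713 `K2E3TwoDepthDepthWitnessCover.exists_depth_witness_twoDepth`, ★ p862799 ∕ p862617 ∕ p862750 upper
shells, ★ p862772 CM dress; NO torus witness, NO Branch-A hypothesis) — so every `(J_e, θ)`-type vector VANISHES there (★ p861573 `toFun_eq_zero_of_mem_cells`), the type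
space of `i(χ)` is again the PLANE `ℂf₁ ⊕ ℂf_w`, and the `2 × 2` algebra of ★ Z2-B goes through word for word.  This file is that restatement, GENERIC in a topological group
`G` with subgroups `H` (= `P`), `B` (= `J_e`), `N`, a one-dimensional `τ` of `H`, a multiplier `θ : G → ℂ`, elements `g₀` (second relevant cell), `w₀, g₁, g₂`, a measure `μ`
on `↥N`, and a FAMILY `R : Set G` of irrelevant-cell representatives with witnesses (letter `hwit` of ★ p861573, verbatim) and the COVER «every `y ∈ G` lies in `H·B`, in
`H·g₀·B`, or in `H·r·B` for some `r ∈ R`» (letter `hcells`).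
* §1 **`eq_of_eigen_of_apply_eq_of_cells`** — two `(B, θ)`-eigen-sections agreeing at `1` and at `g₀` are EQUAL (twin of ★ Z2 `eq_of_eigen_of_apply_eq`).
* §2 **`eq_smul_add_smul_of_eigen_of_cells`** — `f = f(1)·f₁ + f(g₀)·f_w` for a NORMALISED type basis (twin of ★ Z2-B §2).
* §3 **`det_intertwiningIntegral_eq_zero_of_typeVector_of_cells`** — THE BRICK: a type vector `f` with `f(1) ≠ 0` killed by `Λ_{g₁}`, `Λ_{g₂}` (`Λ_g φ = ∫_N φ(w₀ n g) dμ`)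
  forces `Λ_{g₁}f₁·Λ_{g₂}f_w − Λ_{g₁}f_w·Λ_{g₂}f₁ = 0` (twin of ★ Z2-B §4).  The two-cell engine is the case `R = ∅`.
HONEST LABEL.  HC_CM is proved only modulo the 7 printed citations (2 remaining named inputs: hLiu418 = `stmt-HodgeConjecture-24832`, h413 = `stmt-HodgeConjecture-24833`) until rung 0
closes; count-neutral — this file does NOT pay :182 or A2′; no printed citation is discharged.

## References
* [Casselman1980] W. Casselman, *The unramified principal series of p-adic groups I*, Compositio Math. 40 (1980), §3 (the functionals and their matrix on a type space).
* [Casselman1995] W. Casselman, *Introduction to the theory of admissible representations of `p`-adic reductive groups* (1995), §6.3–§6.4, Thm. 6.6.2.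
* [Roche1998] A. Roche, *Types and Hecke algebras for principal series representations of split reductive p-adic groups*, Ann. Sci. ÉNS (4) 31 (1998), §3–§4 (the level
  group `J_χ`; support of `χ̃`-spherical vectors on `P g J_χ` iff `χ̃ = ᵍχ` on `J_χ ∩ g⁻¹Pg`; the two-dimensional module when `w₀ ∈ W_χ`).
* [Keys1984] D. Keys, *Principal series representations of special unitary groups over local fields*, Compositio Math. 51 (1984), §3, §7 Theorem (2) p. 126.
-/

set_option autoImplicit false
-- the mandated namespace has the single-problem summit's repeated segment (`HodgeConjecture.HodgeConjecture`)
set_option linter.dupNamespace false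

noncomputable section

open MeasureTheory

namespace Summit.HodgeConjecture.HodgeConjecture.R90.S1.BranchBDeterminantVanishingCells

open Summit.HodgeConjecture.HodgeConjecture.Cruxes.H413
open Literature.NumberTheory.Automorphic Representation

variable {G : Type*} [Group G] [TopologicalSpace G] [IsTopologicalGroup G] (H : Subgroup G) (τ : Representation ℂ ↥H ℂ)

/-! ## §1 Determination by the values at `1` and `g₀`, modulo irrelevant cells -/

/-- **Two `(B, θ)`-eigen-sections with the same values at `1` and at `g₀` are EQUAL** when every point of `G` lies in `H·B`, in `H·g₀·B`, or in an IRRELEVANT cell `H·r·B`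
(`r ∈ R`, each with a disagreement witness `b_r ∈ B`, `r b_r r⁻¹ ∈ H`, `θ(b_r) ≠ τ(r b_r r⁻¹)`): on the irrelevant cells both sections vanish (★ p861573
`toFun_eq_zero_of_mem_cells`), on the two relevant cells ★ Z2-gen ∕ ★ Z2 read the values off `f(1)`, `f(g₀)`.  Print: the `(J_χ, χ̃)`-type space of `i(χ)` embeds in `ℂ²`
when `w₀ ∈ W_χ`. [cite: Roche1998, §3–§4] [cite: Casselman1995, §6.3] -/
theorem eq_of_eigen_of_apply_eq_of_cells (B : Subgroup G) (θ : G → ℂ) (g₀ : G) (R : Set G)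
    (hwit : ∀ r ∈ R, ∃ b₀ ∈ B, ∃ hb₀H : r * b₀ * r⁻¹ ∈ H, θ b₀ ≠ τ (⟨r * b₀ * r⁻¹, hb₀H⟩ : ↥H) 1)
    (hcells : ∀ y : G, (∃ h ∈ H, ∃ b ∈ B, y = h * b) ∨ (∃ h ∈ H, ∃ b ∈ B, y = h * g₀ * b) ∨ ∃ r ∈ R, ∃ h ∈ H, ∃ b ∈ B, y = h * r * b)
    (f f' : Representation.SmoothInd H τ)
    (heig : ∀ b ∈ B, Representation.smoothIndRep H τ b f = θ b • f) (heig' : ∀ b ∈ B, Representation.smoothIndRep H τ b f' = θ b • f')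
    (h1 : f.toFun 1 = f'.toFun 1) (hg : f.toFun g₀ = f'.toFun g₀) : f = f' := by
  refine Representation.SmoothInd.ext (funext fun y => ?_)
  rcases hcells y with ⟨h, hh, b, hb, rfl⟩ | ⟨h, hh, b, hb, rfl⟩ | hy
  · rw [K2E3TypeVectorSupport.toFun_mul_eq_of_eigen H τ B θ f heig h hh b hb,
      K2E3TypeVectorSupport.toFun_mul_eq_of_eigen H τ B θ f' heig' h hh b hb, h1]
  · rw [K2E3IwahoriPlaneTwoCells.toFun_mul_mul_eq_of_eigen H τ B θ f heig h hh g₀ b hb,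
      K2E3IwahoriPlaneTwoCells.toFun_mul_mul_eq_of_eigen H τ B θ f' heig' h hh g₀ b hb, hg]
  · rw [K2E3BranchAContradictionCells.toFun_eq_zero_of_mem_cells H τ B θ f heig R hwit y hy,
      K2E3BranchAContradictionCells.toFun_eq_zero_of_mem_cells H τ B θ f' heig' R hwit y hy]

/-- A `(B, θ)`-eigen-section vanishing at `1` and at `g₀` is ZERO (cell-family form). [cite: Roche1998, §3–§4] [cite: Casselman1995, §6.3] -/
theorem eq_zero_of_eigen_of_apply_eq_zero_of_cells (B : Subgroup G) (θ : G → ℂ) (g₀ : G) (R : Set G)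
    (hwit : ∀ r ∈ R, ∃ b₀ ∈ B, ∃ hb₀H : r * b₀ * r⁻¹ ∈ H, θ b₀ ≠ τ (⟨r * b₀ * r⁻¹, hb₀H⟩ : ↥H) 1)
    (hcells : ∀ y : G, (∃ h ∈ H, ∃ b ∈ B, y = h * b) ∨ (∃ h ∈ H, ∃ b ∈ B, y = h * g₀ * b) ∨ ∃ r ∈ R, ∃ h ∈ H, ∃ b ∈ B, y = h * r * b)
    (f : Representation.SmoothInd H τ) (heig : ∀ b ∈ B, Representation.smoothIndRep H τ b f = θ b • f)
    (h1 : f.toFun 1 = 0) (hg : f.toFun g₀ = 0) : f = 0 := by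
  refine eq_of_eigen_of_apply_eq_of_cells H τ B θ g₀ R hwit hcells f 0 heig (fun b _ => by rw [map_zero, smul_zero]) ?_ ?_
  · rw [h1]; rfl
  · rw [hg]; rfl

/-! ## §2 A type vector in the coordinates of a normalised type basis -/

/-- **`f = f(1)·f₁ + f(g₀)·f_w`** for a `(B, θ)`-type vector `f` and a NORMALISED `(B, θ)`-type basis (`f₁(1) = 1`, `f₁(g₀) = 0`, `f_w(1) = 0`, `f_w(g₀) = 1`), cell-family
form (both sides are `(B, θ)`-eigen, ★ Z2-B `eigen_smul_add_smul`, and agree at `1` and `g₀`).  Print: the `(J_χ, χ̃)`-plane `ℂf₁ ⊕ ℂf_w` of `i(χ)` in Branch B at positive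
depth. [cite: Roche1998, §3–§4] [cite: Casselman1995, §6.3] -/
theorem eq_smul_add_smul_of_eigen_of_cells (B : Subgroup G) (θ : G → ℂ) (g₀ : G) (R : Set G)
    (hwit : ∀ r ∈ R, ∃ b₀ ∈ B, ∃ hb₀H : r * b₀ * r⁻¹ ∈ H, θ b₀ ≠ τ (⟨r * b₀ * r⁻¹, hb₀H⟩ : ↥H) 1)
    (hcells : ∀ y : G, (∃ h ∈ H, ∃ b ∈ B, y = h * b) ∨ (∃ h ∈ H, ∃ b ∈ B, y = h * g₀ * b) ∨ ∃ r ∈ R, ∃ h ∈ H, ∃ b ∈ B, y = h * r * b)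
    (f₁ f_w f : Representation.SmoothInd H τ)
    (heig₁ : ∀ x ∈ B, Representation.smoothIndRep H τ x f₁ = θ x • f₁) (heig_w : ∀ x ∈ B, Representation.smoothIndRep H τ x f_w = θ x • f_w)
    (heig : ∀ x ∈ B, Representation.smoothIndRep H τ x f = θ x • f)
    (h11 : f₁.toFun 1 = 1) (h1g : f₁.toFun g₀ = 0) (hw1 : f_w.toFun 1 = 0) (hwg : f_w.toFun g₀ = 1) :
    f = f.toFun 1 • f₁ + f.toFun g₀ • f_w := by
  refine eq_of_eigen_of_apply_eq_of_cells H τ B θ g₀ R hwit hcells f _ heig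
    (K2E3BranchBDeterminantVanishing.eigen_smul_add_smul H τ B θ f₁ f_w heig₁ heig_w (f.toFun 1) (f.toFun g₀)) ?_ ?_
  · rw [SmoothInd.toFun_add, SmoothInd.toFun_smul, SmoothInd.toFun_smul, Pi.add_apply, Pi.smul_apply, Pi.smul_apply, smul_eq_mul, smul_eq_mul,
      h11, hw1, mul_one, mul_zero, add_zero]
  · rw [SmoothInd.toFun_add, SmoothInd.toFun_smul, SmoothInd.toFun_smul, Pi.add_apply, Pi.smul_apply, Pi.smul_apply, smul_eq_mul, smul_eq_mul,
      h1g, hwg, mul_zero, mul_one, zero_add]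

/-! ## §3 `det M = 0` (cell-family form) -/

/-- **IN BRANCH B AT POSITIVE DEPTH, «REDUCIBLE ⟹ det M = 0» (cell-family form).**  Let `f₁, f_w` be a NORMALISED `(B, θ)`-type basis of `Ind_H^G τ` (`f₁(1) = 1,
f₁(g₀) = 0, f_w(1) = 0, f_w(g₀) = 1`) and suppose every point of `G` lies in `H·B`, `H·g₀·B` or an irrelevant cell `H·r·B` (`r ∈ R`, witnessed); let
`Λ_g(φ) := ∫_N φ(w₀ n g) dμ(n)` with the four cell integrals `Λ_{g₁}f₁, Λ_{g₁}f_w, Λ_{g₂}f₁, Λ_{g₂}f_w` integrable, and let `f` be a `(B, θ)`-TYPE VECTOR with `f(1) ≠ 0`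
KILLED by `Λ_{g₁}` and `Λ_{g₂}` (★ V1 `K2E3IntertwiningKernelOfReducible` on the reducing `V ∋ f`; ★ V2b ∕ Z2A-2 for the type vector at the datum `K 0 = J_e`).  Then
**`Λ_{g₁}f₁ · Λ_{g₂}f_w − Λ_{g₁}f_w · Λ_{g₂}f₁ = 0`** — the Casselman-pair determinant on the `(J_e, θ)`-plane vanishes (print: `g₁ = 1`, `g₂ = w₀⁻¹`,
`det M = G₁G₂ − vol(N ∩ J_e)·vol(N̄ ∩ J_e)`).  The two-cell case `R = ∅` is ★ Z2-B. [cite: Casselman1980, §3] [cite: Casselman1995, §6.4, Thm. 6.6.2]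
[cite: Keys1984, §3, §7 Theorem (2) p. 126] [cite: Roche1998, §3–§4] -/
theorem det_intertwiningIntegral_eq_zero_of_typeVector_of_cells (B : Subgroup G) (θ : G → ℂ) (g₀ : G) (R : Set G)
    (hwit : ∀ r ∈ R, ∃ b₀ ∈ B, ∃ hb₀H : r * b₀ * r⁻¹ ∈ H, θ b₀ ≠ τ (⟨r * b₀ * r⁻¹, hb₀H⟩ : ↥H) 1)
    (hcells : ∀ y : G, (∃ h ∈ H, ∃ b ∈ B, y = h * b) ∨ (∃ h ∈ H, ∃ b ∈ B, y = h * g₀ * b) ∨ ∃ r ∈ R, ∃ h ∈ H, ∃ b ∈ B, y = h * r * b)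
    (N : Subgroup G) [MeasurableSpace ↥N] (μ : Measure ↥N) (w₀ g₁ g₂ : G)
    (f₁ f_w : Representation.SmoothInd H τ)
    (heig₁ : ∀ x ∈ B, Representation.smoothIndRep H τ x f₁ = θ x • f₁) (heig_w : ∀ x ∈ B, Representation.smoothIndRep H τ x f_w = θ x • f_w)
    (h11 : f₁.toFun 1 = 1) (h1g : f₁.toFun g₀ = 0) (hw1 : f_w.toFun 1 = 0) (hwg : f_w.toFun g₀ = 1)
    (hi₁₁ : Integrable (fun n : ↥N => f₁.toFun (w₀ * (n : G) * g₁)) μ) (hiw₁ : Integrable (fun n : ↥N => f_w.toFun (w₀ * (n : G) * g₁)) μ)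
    (hi₁₂ : Integrable (fun n : ↥N => f₁.toFun (w₀ * (n : G) * g₂)) μ) (hiw₂ : Integrable (fun n : ↥N => f_w.toFun (w₀ * (n : G) * g₂)) μ)
    (f : Representation.SmoothInd H τ) (heig : ∀ x ∈ B, Representation.smoothIndRep H τ x f = θ x • f) (hf1 : f.toFun 1 ≠ 0)
    (hΛ₁ : ∫ n : ↥N, f.toFun (w₀ * (n : G) * g₁) ∂μ = 0) (hΛ₂ : ∫ n : ↥N, f.toFun (w₀ * (n : G) * g₂) ∂μ = 0) :
    (∫ n : ↥N, f₁.toFun (w₀ * (n : G) * g₁) ∂μ) * (∫ n : ↥N, f_w.toFun (w₀ * (n : G) * g₂) ∂μ) -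
      (∫ n : ↥N, f_w.toFun (w₀ * (n : G) * g₁) ∂μ) * (∫ n : ↥N, f₁.toFun (w₀ * (n : G) * g₂) ∂μ) = 0 := by
  have hf := eq_smul_add_smul_of_eigen_of_cells H τ B θ g₀ R hwit hcells f₁ f_w f heig₁ heig_w heig h11 h1g hw1 hwg
  have h1 := K2E3BranchBDeterminantVanishing.integral_conj_mul_eq_of_eq_smul_add_smul H τ N μ w₀ g₁ f₁ f_w f (f.toFun 1) (f.toFun g₀) hf hi₁₁ hiw₁
  have h2 := K2E3BranchBDeterminantVanishing.integral_conj_mul_eq_of_eq_smul_add_smul H τ N μ w₀ g₂ f₁ f_w f (f.toFun 1) (f.toFun g₀) hf hi₁₂ hiw₂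
  rw [hΛ₁] at h1
  rw [hΛ₂] at h2
  exact K2E3BranchBDeterminantVanishing.det_eq_zero_of_kernel_vector_fst_ne_zero hf1 h1.symm h2.symm

/-- **A TYPE VECTOR VANISHES ON EVERY IRRELEVANT CELL — so the two vanishing integrals only see the plane.**  Convenience restatement of ★ p861573 §1 for consumers of
this file (the witnesses are the depth witnesses of ★ p862713 ∕ p862799 read through the CM dress ★ p862772 ∕ p862750). [cite: Roche1998, §3–§4] -/
theorem toFun_eq_zero_of_mem_cells (B : Subgroup G) (θ : G → ℂ) (R : Set G)
    (hwit : ∀ r ∈ R, ∃ b₀ ∈ B, ∃ hb₀H : r * b₀ * r⁻¹ ∈ H, θ b₀ ≠ τ (⟨r * b₀ * r⁻¹, hb₀H⟩ : ↥H) 1)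
    (f : Representation.SmoothInd H τ) (heig : ∀ b ∈ B, Representation.smoothIndRep H τ b f = θ b • f)
    (x : G) (hx : ∃ r ∈ R, ∃ h ∈ H, ∃ b' ∈ B, x = h * r * b') : f.toFun x = 0 :=
  K2E3BranchAContradictionCells.toFun_eq_zero_of_mem_cells H τ B θ f heig R hwit x hx

end Summit.HodgeConjecture.HodgeConjecture.R90.S1.BranchBDeterminantVanishingCells

end
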